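import Mathlib.Analysis.InnerProductSpace.Basic
import Mathlib.Analysis.SpecialFunctions.Pow.Real
import HarnessLib

/-!
# Crux `HistoryTailL` (stmt-QuantumFields-19936), K2 organ `hImproveCoreFlat`, road R1 brick B2′ — FILE H-1 «THE RAY PROJECTION ONTO THE UNIT
# SPHERE FROM AN INTERIOR CENTRE»: it fixes the sphere, and it is `6∕‖y − p‖`-Lipschitz WITHOUT CALCULUS (Hardt–Kinderlehrer–Lin's device)

Cell `ym3-torus` (YM ladder rung R3 = continuum SU(2) Yang–Mills on T³ — a RUNG, NOT the Clay problem: not d = 4, not infinite volume, not a mass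
gap); TWIN-WIDTH helper seat `ym-ust-19936-w7` g13.  Helper `--supports stmt-QuantumFields-19936`; THEOREMS ONLY (0 `def`, 0 `sorry`, default
heartbeats), Mathlib only, any real inner-product space `V`.

THE OBJECT (spelled out in every statement, no definition).  For a centre `p` with `‖p‖ ≤ ½` and a unit direction `e`,
`s(p,e) := −⟪p,e⟫ + √(⟪p,e⟫² + (1 − ‖p‖²))` is the positive root of `‖p + s·e‖ = 1`; the RAY PROJECTION of `y ≠ p` is
`π_p(y) := p + s(p, e_y)·e_y`, `e_y := ‖y − p‖⁻¹·(y − p)` — the point where the ray from `p` through `y` leaves the unit ball.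
Hardt–Kinderlehrer–Lin average such projections over the centre `p` to produce sphere-valued competitors from arbitrary `ℝ^{k+1}`-valued
ones; files H-2 (averaging over `p ∈ B_{1∕2} ⊂ ℝ⁴`) and H-3 (the lattice Luckhaus-type interpolation lemma B2′ for `S³`-valued lattice maps)
consume this file.

WHAT IS PROVED (ns `…Theorems.PoincareLipschitzSphereRayProjection`).
* §1 `sqrt_sq_add_sub_sqrt_sq_add_le` (`|√(x²+c) − √(x′²+c)| ≤ |x − x′|`, `c > 0`), `root_nonneg`, `root_le_two`, ★`abs_root_sub_root_le`
  (`s(p,·)` is 1-Lipschitz for `‖p‖ ≤ ½`), ★`norm_add_root_smul_eq_one` (`‖e‖ = 1 ⇒ ‖p + s(p,e)e‖ = 1`).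
* §2 `norm_normalize_sub_normalize_le` (`‖û − v̂‖ ≤ 2‖u − v‖∕‖u‖` for nonzero `u, v` — no case split on which is longer),
  ★`norm_sphere_point_sub_le` (`‖(p + s(p,e)e) − (p + s(p,e′)e′)‖ ≤ 3‖e − e′‖` on unit `e, e′`).
* §3 ★★`norm_rayProj_eq_one` (`π_p(y) ∈ S`), ★★`rayProj_eq_self_of_norm_eq_one` (`‖y‖ = 1 ⇒ π_p(y) = y`), ★★★`norm_rayProj_sub_rayProj_le`
  (`‖π_p(y) − π_p(z)‖ ≤ 6‖y − z‖∕‖y − p‖` for `y, z ≠ p`) and its square `…_sq_le` (`≤ 36‖y − z‖²∕‖y − p‖²`).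
HONEST SCOPE.  Elementary geometry of the sphere; NOTHING here proves `hImproveCoreFlat`, K1, `MeanDeviationL`, `BlockLipschitzL` or `HistoryTailL`.
YM₃ on T³ is rung R3, not Clay; YM gap NOT proved; no summit statement is proved here.

References: R. Hardt, D. Kinderlehrer, F.-H. Lin, Comm. Math. Phys. 105 (1986) 547–570 [HardtKinderlehrerLin1986] (§2, projection device);
S. Luckhaus, Indiana Univ. Math. J. 37 (1988) 349–367 (Lemma 1, the interpolation lemma this device replaces for sphere targets).
-/

set_option autoImplicit false

noncomputable section

open scoped InnerProductSpace
open RealInnerProductSpace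

namespace Summit.QuantumFields.YangMills.Theorems.PoincareLipschitzSphereRayProjection

variable {V : Type*} [NormedAddCommGroup V] [InnerProductSpace ℝ V]

/-! ## §1 The positive root `s(p,e) = −⟪p,e⟫ + √(⟪p,e⟫² + (1 − ‖p‖²))` -/

/-- `x ↦ √(x² + c)` is 1-Lipschitz (`c > 0`): `|√(x²+c) − √(x′²+c)| ≤ |x − x′|`. [folklore] -/
theorem sqrt_sq_add_sub_sqrt_sq_add_le {x x' c : ℝ} (hc : 0 < c) :
    |Real.sqrt (x ^ 2 + c) - Real.sqrt (x' ^ 2 + c)| ≤ |x - x'| := by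
  set u := Real.sqrt (x ^ 2 + c) with hu
  set v := Real.sqrt (x' ^ 2 + c) with hv
  have hx0 : 0 ≤ x ^ 2 + c := by positivity
  have hx0' : 0 ≤ x' ^ 2 + c := by positivity
  have hu0 : 0 < u := Real.sqrt_pos.mpr (by positivity)
  have hv0 : 0 < v := Real.sqrt_pos.mpr (by positivity)
  have hu2 : u ^ 2 = x ^ 2 + c := by rw [hu, Real.sq_sqrt hx0]
  have hv2 : v ^ 2 = x' ^ 2 + c := by rw [hv, Real.sq_sqrt hx0']
  have hxu : |x| ≤ u := by
    rw [← Real.sqrt_sq_eq_abs, hu]; exact Real.sqrt_le_sqrt (by linarith)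
  have hxv : |x'| ≤ v := by
    rw [← Real.sqrt_sq_eq_abs, hv]; exact Real.sqrt_le_sqrt (by linarith)
  -- `(u − v)(u + v) = (x − x′)(x + x′)` and `|x + x′| ≤ u + v`
  have hkey : (u - v) * (u + v) = (x - x') * (x + x') := by nlinarith [hu2, hv2]
  have hsum : |x + x'| ≤ u + v := (abs_add_le x x').trans (add_le_add hxu hxv)
  have hpos : 0 < u + v := by linarith
  have h1 : |u - v| * (u + v) = |x - x'| * |x + x'| := by
    rw [← abs_of_pos hpos, ← abs_mul, hkey, abs_mul]
  have h2 : |u - v| * (u + v) ≤ |x - x'| * (u + v) := by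
    rw [h1]; exact mul_le_mul_of_nonneg_left hsum (abs_nonneg _)
  exact le_of_mul_le_mul_right h2 hpos

/-- The root is nonnegative: `0 ≤ −⟪p,e⟫ + √(⟪p,e⟫² + (1 − ‖p‖²))` for `‖p‖ ≤ 1`. [folklore] -/
theorem root_nonneg (p e : V) (hp : ‖p‖ ≤ 1) :
    0 ≤ -⟪p, e⟫ + Real.sqrt (⟪p, e⟫ ^ 2 + (1 - ‖p‖ ^ 2)) := by
  have hc : 0 ≤ 1 - ‖p‖ ^ 2 := by nlinarith [norm_nonneg p]
  have h1 : |⟪p, e⟫| ≤ Real.sqrt (⟪p, e⟫ ^ 2 + (1 - ‖p‖ ^ 2)) := by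
    rw [← Real.sqrt_sq_eq_abs]; exact Real.sqrt_le_sqrt (by linarith)
  linarith [le_abs_self ⟪p, e⟫]

/-- The root is at most `2` on unit directions for `‖p‖ ≤ ½`. [folklore] -/
theorem root_le_two (p e : V) (hp : ‖p‖ ≤ 1 / 2) (he : ‖e‖ = 1) :
    -⟪p, e⟫ + Real.sqrt (⟪p, e⟫ ^ 2 + (1 - ‖p‖ ^ 2)) ≤ 2 := by
  have hB : |⟪p, e⟫| ≤ 1 / 2 := by
    calc |⟪p, e⟫| ≤ ‖p‖ * ‖e‖ := abs_real_inner_le_norm p e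
      _ ≤ 1 / 2 * 1 := mul_le_mul hp he.le (norm_nonneg _) (by norm_num)
      _ = 1 / 2 := by ring
  have hB2 : ⟪p, e⟫ ^ 2 ≤ 1 / 4 := by
    have := abs_le.mp hB; nlinarith [this.1, this.2]
  have hs : Real.sqrt (⟪p, e⟫ ^ 2 + (1 - ‖p‖ ^ 2)) ≤ 3 / 2 := by
    rw [Real.sqrt_le_left (by norm_num)]
    nlinarith [norm_nonneg p]
  linarith [neg_le_abs ⟪p, e⟫, le_abs_self ⟪p, e⟫, abs_le.mp hB]

/-- ★ `s(p,·)` is 1-Lipschitz for `‖p‖ ≤ ½`: `|s(p,e) − s(p,e′)| ≤ ‖e − e′‖` (any `e, e′`). [folklore] -/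
theorem abs_root_sub_root_le (p e e' : V) (hp : ‖p‖ ≤ 1 / 2) :
    |(-⟪p, e⟫ + Real.sqrt (⟪p, e⟫ ^ 2 + (1 - ‖p‖ ^ 2))) -
      (-⟪p, e'⟫ + Real.sqrt (⟪p, e'⟫ ^ 2 + (1 - ‖p‖ ^ 2)))| ≤ ‖e - e'‖ := by
  have hc : 0 < 1 - ‖p‖ ^ 2 := by nlinarith [norm_nonneg p]
  have hB : |⟪p, e⟫ - ⟪p, e'⟫| ≤ 1 / 2 * ‖e - e'‖ := by
    rw [← inner_sub_right]
    calc |⟪p, e - e'⟫| ≤ ‖p‖ * ‖e - e'‖ := abs_real_inner_le_norm p _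
      _ ≤ 1 / 2 * ‖e - e'‖ := mul_le_mul_of_nonneg_right hp (norm_nonneg _)
  have hS := sqrt_sq_add_sub_sqrt_sq_add_le (x := ⟪p, e⟫) (x' := ⟪p, e'⟫) hc
  calc |(-⟪p, e⟫ + Real.sqrt (⟪p, e⟫ ^ 2 + (1 - ‖p‖ ^ 2))) -
        (-⟪p, e'⟫ + Real.sqrt (⟪p, e'⟫ ^ 2 + (1 - ‖p‖ ^ 2)))|
      = |-(⟪p, e⟫ - ⟪p, e'⟫) +
          (Real.sqrt (⟪p, e⟫ ^ 2 + (1 - ‖p‖ ^ 2)) - Real.sqrt (⟪p, e'⟫ ^ 2 + (1 - ‖p‖ ^ 2)))| := by ring_nf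
    _ ≤ |-(⟪p, e⟫ - ⟪p, e'⟫)| +
          |Real.sqrt (⟪p, e⟫ ^ 2 + (1 - ‖p‖ ^ 2)) - Real.sqrt (⟪p, e'⟫ ^ 2 + (1 - ‖p‖ ^ 2))| := abs_add_le _ _
    _ ≤ 1 / 2 * ‖e - e'‖ + |⟪p, e⟫ - ⟪p, e'⟫| := by rw [abs_neg]; exact add_le_add hB hS
    _ ≤ 1 / 2 * ‖e - e'‖ + 1 / 2 * ‖e - e'‖ := by linarith
    _ = ‖e - e'‖ := by ring

/-- ★ THE ROOT PROPERTY: on a unit direction `e`, `p + s(p,e)·e` lies on the unit sphere (`‖p‖ ≤ 1`). [folklore] -/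
theorem norm_add_root_smul_eq_one (p e : V) (hp : ‖p‖ ≤ 1) (he : ‖e‖ = 1) :
    ‖p + (-⟪p, e⟫ + Real.sqrt (⟪p, e⟫ ^ 2 + (1 - ‖p‖ ^ 2))) • e‖ = 1 := by
  set B := ⟪p, e⟫ with hB
  set σ := -B + Real.sqrt (B ^ 2 + (1 - ‖p‖ ^ 2)) with hσ
  have hc : 0 ≤ B ^ 2 + (1 - ‖p‖ ^ 2) := by nlinarith [norm_nonneg p]
  have hsq : Real.sqrt (B ^ 2 + (1 - ‖p‖ ^ 2)) ^ 2 = B ^ 2 + (1 - ‖p‖ ^ 2) := Real.sq_sqrt hc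
  -- `σ² + 2σB + ‖p‖² − 1 = 0`
  have hquad : σ ^ 2 + 2 * σ * B + ‖p‖ ^ 2 = 1 := by
    rw [hσ]; nlinarith [hsq]
  have h2 : ‖p + σ • e‖ ^ 2 = 1 := by
    rw [norm_add_sq_real, norm_smul, he, mul_one, Real.norm_eq_abs, sq_abs, inner_smul_right, ← hB]
    nlinarith [hquad]
  have h0 : 0 ≤ ‖p + σ • e‖ := norm_nonneg _
  nlinarith [h2, h0]

/-! ## §2 Normalisation is `2∕‖u‖`-Lipschitz; the sphere point is `3`-Lipschitz in the direction -/

/-- `‖û − v̂‖ ≤ 2‖u − v‖∕‖u‖` for nonzero `u, v` (`û = ‖u‖⁻¹u`): `û − v̂ = (u − v)∕‖u‖ + v(‖v‖ − ‖u‖)∕(‖u‖‖v‖)` — valid whichever of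
`u, v` is longer. [folklore] -/
theorem norm_normalize_sub_normalize_le (u v : V) (hu : u ≠ 0) (hv : v ≠ 0) :
    ‖‖u‖⁻¹ • u - ‖v‖⁻¹ • v‖ ≤ 2 * ‖u - v‖ / ‖u‖ := by
  have hu0 : 0 < ‖u‖ := norm_pos_iff.mpr hu
  have hv0 : 0 < ‖v‖ := norm_pos_iff.mpr hv
  have hsplit : ‖u‖⁻¹ • u - ‖v‖⁻¹ • v = ‖u‖⁻¹ • (u - v) + (‖u‖⁻¹ - ‖v‖⁻¹) • v := by
    rw [smul_sub, sub_smul]; abel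
  have h1 : ‖‖u‖⁻¹ • (u - v)‖ = ‖u - v‖ / ‖u‖ := by
    rw [norm_smul, Real.norm_eq_abs, abs_of_pos (inv_pos.mpr hu0), inv_mul_eq_div]
  have h2 : ‖(‖u‖⁻¹ - ‖v‖⁻¹) • v‖ ≤ ‖u - v‖ / ‖u‖ := by
    rw [norm_smul, Real.norm_eq_abs]
    have hdiff : |‖u‖⁻¹ - ‖v‖⁻¹| * ‖v‖ = |‖v‖ - ‖u‖| / ‖u‖ := by
      rw [inv_sub_inv hu0.ne' hv0.ne', abs_div, abs_of_pos (mul_pos hu0 hv0)]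
      field_simp
    rw [hdiff]
    exact div_le_div_of_nonneg_right ((abs_norm_sub_norm_le v u).trans (by rw [norm_sub_rev])) hu0.le
  calc ‖‖u‖⁻¹ • u - ‖v‖⁻¹ • v‖ = ‖‖u‖⁻¹ • (u - v) + (‖u‖⁻¹ - ‖v‖⁻¹) • v‖ := by rw [hsplit]
    _ ≤ ‖‖u‖⁻¹ • (u - v)‖ + ‖(‖u‖⁻¹ - ‖v‖⁻¹) • v‖ := norm_add_le _ _
    _ ≤ ‖u - v‖ / ‖u‖ + ‖u - v‖ / ‖u‖ := by rw [h1]; exact add_le_add le_rfl h2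
    _ = 2 * ‖u - v‖ / ‖u‖ := by ring

/-- ★ The sphere point `e ↦ p + s(p,e)·e` is 3-Lipschitz on unit directions (`‖p‖ ≤ ½`): `s ≤ 2` carries `e − e′`, and `s` is 1-Lipschitz.
[cite: HardtKinderlehrerLin1986, §2] -/
theorem norm_sphere_point_sub_le (p e e' : V) (hp : ‖p‖ ≤ 1 / 2) (he : ‖e‖ = 1) (he' : ‖e'‖ = 1) :
    ‖(p + (-⟪p, e⟫ + Real.sqrt (⟪p, e⟫ ^ 2 + (1 - ‖p‖ ^ 2))) • e) -
      (p + (-⟪p, e'⟫ + Real.sqrt (⟪p, e'⟫ ^ 2 + (1 - ‖p‖ ^ 2))) • e')‖ ≤ 3 * ‖e - e'‖ := by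
  set σ := -⟪p, e⟫ + Real.sqrt (⟪p, e⟫ ^ 2 + (1 - ‖p‖ ^ 2)) with hσ
  set σ' := -⟪p, e'⟫ + Real.sqrt (⟪p, e'⟫ ^ 2 + (1 - ‖p‖ ^ 2)) with hσ'
  have hp1 : ‖p‖ ≤ 1 := hp.trans (by norm_num)
  have hσ0 : 0 ≤ σ := root_nonneg p e hp1
  have hσ2 : σ ≤ 2 := root_le_two p e hp he
  have hdiff : |σ - σ'| ≤ ‖e - e'‖ := abs_root_sub_root_le p e e' hp
  have hsplit : (p + σ • e) - (p + σ' • e') = σ • (e - e') + (σ - σ') • e' := by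
    rw [smul_sub, sub_smul]; abel
  calc ‖(p + σ • e) - (p + σ' • e')‖ = ‖σ • (e - e') + (σ - σ') • e'‖ := by rw [hsplit]
    _ ≤ ‖σ • (e - e')‖ + ‖(σ - σ') • e'‖ := norm_add_le _ _
    _ = |σ| * ‖e - e'‖ + |σ - σ'| * 1 := by rw [norm_smul, norm_smul, Real.norm_eq_abs, Real.norm_eq_abs, he']
    _ ≤ 2 * ‖e - e'‖ + ‖e - e'‖ * 1 := by
        rw [abs_of_nonneg hσ0]
        exact add_le_add (mul_le_mul_of_nonneg_right hσ2 (norm_nonneg _)) (mul_le_mul_of_nonneg_right hdiff zero_le_one)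
    _ = 3 * ‖e - e'‖ := by ring

/-! ## §3 The ray projection: on the sphere, fixes the sphere, `6∕‖y − p‖`-Lipschitz -/

/-- ★★ The ray projection `π_p(y) = p + s(p, e_y)·e_y`, `e_y = ‖y−p‖⁻¹(y−p)`, lands on the unit sphere (`‖p‖ ≤ ½`, `y ≠ p`).
[cite: HardtKinderlehrerLin1986, §2] -/
theorem norm_rayProj_eq_one (p y : V) (hp : ‖p‖ ≤ 1 / 2) (hy : y ≠ p) :
    ‖p + (-⟪p, ‖y - p‖⁻¹ • (y - p)⟫ + Real.sqrt (⟪p, ‖y - p‖⁻¹ • (y - p)⟫ ^ 2 + (1 - ‖p‖ ^ 2))) •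
        (‖y - p‖⁻¹ • (y - p))‖ = 1 := by
  have hyp : y - p ≠ 0 := sub_ne_zero.mpr hy
  have he : ‖‖y - p‖⁻¹ • (y - p)‖ = 1 := by
    rw [norm_smul, Real.norm_eq_abs, abs_of_pos (inv_pos.mpr (norm_pos_iff.mpr hyp)),
      inv_mul_cancel₀ (norm_ne_zero_iff.mpr hyp)]
  exact norm_add_root_smul_eq_one p _ (hp.trans (by norm_num)) he

/-- ★★ The ray projection FIXES THE SPHERE: `‖y‖ = 1 ⇒ π_p(y) = y` (`‖p‖ ≤ ½`): with `d = ‖y − p‖ ≥ ½`,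
`√(⟪p,e_y⟫² + 1 − ‖p‖²) = d + ⟪p,e_y⟫` since `‖y − p‖² + 2⟪p, y − p⟫ = 1 − ‖p‖²`. [cite: HardtKinderlehrerLin1986, §2] -/
theorem rayProj_eq_self_of_norm_eq_one (p y : V) (hp : ‖p‖ ≤ 1 / 2) (hy : ‖y‖ = 1) :
    p + (-⟪p, ‖y - p‖⁻¹ • (y - p)⟫ + Real.sqrt (⟪p, ‖y - p‖⁻¹ • (y - p)⟫ ^ 2 + (1 - ‖p‖ ^ 2))) •
        (‖y - p‖⁻¹ • (y - p)) = y := by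
  set d := ‖y - p‖ with hd
  have hd0 : 1 / 2 ≤ d := by
    have := norm_sub_norm_le y p
    rw [hd]; linarith [norm_sub_rev y p, abs_norm_sub_norm_le y p, norm_nonneg (y - p),
      (le_abs_self (‖y‖ - ‖p‖)).trans (abs_norm_sub_norm_le y p)]
  have hdpos : 0 < d := by linarith
  have hyp : y - p ≠ 0 := by
    intro h; rw [hd, h, norm_zero] at hdpos; exact lt_irrefl _ hdpos
  -- `⟪p, e⟫ = ⟪p, y − p⟫ ∕ d`
  have hB : ⟪p, d⁻¹ • (y - p)⟫ = d⁻¹ * ⟪p, y - p⟫ := by rw [inner_smul_right]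
  -- the key identity `‖y − p‖² + 2⟪p, y − p⟫ = 1 − ‖p‖²`
  have hkey : d ^ 2 + 2 * ⟪p, y - p⟫ = 1 - ‖p‖ ^ 2 := by
    have h1 : d ^ 2 = ‖y‖ ^ 2 - 2 * ⟪y, p⟫ + ‖p‖ ^ 2 := by rw [hd]; exact norm_sub_sq_real y p
    rw [real_inner_comm p y] at h1
    rw [inner_sub_right, real_inner_self_eq_norm_sq, h1, hy]
    ring
  -- the square root equals `d + ⟪p, e⟫`
  have hBabs : |d⁻¹ * ⟪p, y - p⟫| ≤ 1 / 2 := by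
    rw [← hB]
    calc |⟪p, d⁻¹ • (y - p)⟫| ≤ ‖p‖ * ‖d⁻¹ • (y - p)‖ := abs_real_inner_le_norm _ _
      _ = ‖p‖ * 1 := by
          rw [norm_smul, Real.norm_eq_abs, abs_of_pos (inv_pos.mpr hdpos), ← hd, inv_mul_cancel₀ hdpos.ne']
      _ ≤ 1 / 2 := by linarith
  have hnonneg : 0 ≤ d + d⁻¹ * ⟪p, y - p⟫ := by
    linarith [neg_abs_le (d⁻¹ * ⟪p, y - p⟫)]
  have hsqrt : Real.sqrt ((d⁻¹ * ⟪p, y - p⟫) ^ 2 + (1 - ‖p‖ ^ 2)) = d + d⁻¹ * ⟪p, y - p⟫ := by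
    rw [Real.sqrt_eq_iff_mul_self_eq (by nlinarith [norm_nonneg p, hp]) hnonneg]
    have hdd : d * d⁻¹ = 1 := mul_inv_cancel₀ hdpos.ne'
    nlinarith [hkey, hdd]
  rw [hB, hsqrt]
  have hcoef : -(d⁻¹ * ⟪p, y - p⟫) + (d + d⁻¹ * ⟪p, y - p⟫) = d := by ring
  rw [hcoef, smul_smul, mul_inv_cancel₀ hdpos.ne', one_smul]
  abel

/-- ★★★ **THE RAY PROJECTION IS `6∕‖y − p‖`-LIPSCHITZ** (`‖p‖ ≤ ½`, `y, z ≠ p`):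
`‖π_p(y) − π_p(z)‖ ≤ 3‖e_y − e_z‖ ≤ 6‖y − z‖∕‖y − p‖` — the Hardt–Kinderlehrer–Lin kernel bound `|Dπ_p(y)| ≲ 1∕|y − p|` in finite-difference
form, with no smallness and no calculus. [cite: HardtKinderlehrerLin1986, §2] -/
theorem norm_rayProj_sub_rayProj_le (p y z : V) (hp : ‖p‖ ≤ 1 / 2) (hy : y ≠ p) (hz : z ≠ p) :
    ‖(p + (-⟪p, ‖y - p‖⁻¹ • (y - p)⟫ + Real.sqrt (⟪p, ‖y - p‖⁻¹ • (y - p)⟫ ^ 2 + (1 - ‖p‖ ^ 2))) •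
          (‖y - p‖⁻¹ • (y - p))) -
      (p + (-⟪p, ‖z - p‖⁻¹ • (z - p)⟫ + Real.sqrt (⟪p, ‖z - p‖⁻¹ • (z - p)⟫ ^ 2 + (1 - ‖p‖ ^ 2))) •
          (‖z - p‖⁻¹ • (z - p)))‖ ≤ 6 * ‖y - z‖ / ‖y - p‖ := by
  have hyp : y - p ≠ 0 := sub_ne_zero.mpr hy
  have hzp : z - p ≠ 0 := sub_ne_zero.mpr hz
  have hunit : ∀ w : V, w ≠ 0 → ‖‖w‖⁻¹ • w‖ = 1 := fun w hw => by
    rw [norm_smul, Real.norm_eq_abs, abs_of_pos (inv_pos.mpr (norm_pos_iff.mpr hw)),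
      inv_mul_cancel₀ (norm_ne_zero_iff.mpr hw)]
  have h1 := norm_sphere_point_sub_le p (‖y - p‖⁻¹ • (y - p)) (‖z - p‖⁻¹ • (z - p)) hp (hunit _ hyp) (hunit _ hzp)
  have h2 := norm_normalize_sub_normalize_le (y - p) (z - p) hyp hzp
  have h3 : ‖(y - p) - (z - p)‖ = ‖y - z‖ := by congr 1; abel
  rw [h3] at h2
  have hyp0 : 0 < ‖y - p‖ := norm_pos_iff.mpr hyp
  calc _ ≤ 3 * ‖‖y - p‖⁻¹ • (y - p) - ‖z - p‖⁻¹ • (z - p)‖ := h1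
    _ ≤ 3 * (2 * ‖y - z‖ / ‖y - p‖) := mul_le_mul_of_nonneg_left h2 (by norm_num)
    _ = 6 * ‖y - z‖ / ‖y - p‖ := by ring

/-- The squared form used bond by bond in H-3: `‖π_p(y) − π_p(z)‖² ≤ 36·‖y − z‖²∕‖y − p‖²`. [cite: HardtKinderlehrerLin1986, §2] -/
theorem norm_rayProj_sub_rayProj_sq_le (p y z : V) (hp : ‖p‖ ≤ 1 / 2) (hy : y ≠ p) (hz : z ≠ p) :
    ‖(p + (-⟪p, ‖y - p‖⁻¹ • (y - p)⟫ + Real.sqrt (⟪p, ‖y - p‖⁻¹ • (y - p)⟫ ^ 2 + (1 - ‖p‖ ^ 2))) •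
          (‖y - p‖⁻¹ • (y - p))) -
      (p + (-⟪p, ‖z - p‖⁻¹ • (z - p)⟫ + Real.sqrt (⟪p, ‖z - p‖⁻¹ • (z - p)⟫ ^ 2 + (1 - ‖p‖ ^ 2))) •
          (‖z - p‖⁻¹ • (z - p)))‖ ^ 2 ≤ 36 * ‖y - z‖ ^ 2 / ‖y - p‖ ^ 2 := by
  have h := norm_rayProj_sub_rayProj_le p y z hp hy hz
  have hyp0 : 0 < ‖y - p‖ := norm_pos_iff.mpr (sub_ne_zero.mpr hy)
  have h0 : 0 ≤ 6 * ‖y - z‖ / ‖y - p‖ := by positivity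
  have hsq := pow_le_pow_left₀ (norm_nonneg _) h 2
  calc _ ≤ (6 * ‖y - z‖ / ‖y - p‖) ^ 2 := hsq
    _ = 36 * ‖y - z‖ ^ 2 / ‖y - p‖ ^ 2 := by rw [div_pow, mul_pow]; norm_num

end Summit.QuantumFields.YangMills.Theorems.PoincareLipschitzSphereRayProjection

end
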